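import Summits.ResolutionOfSingularities.ResolutionOfSingularities.Theorems.RiderCutKernels
import Summits.ResolutionOfSingularities.ResolutionOfSingularities.Theorems.MaxContactCutCouplingCut
import HarnessLib

/-!
# MaxContactCutRiderCut — decomp-res node «RiderCut» (lens-4 g19; critic row 123: landing order 17:52:13Z)
refining the MaxContactCut aside 32260 (host of the lens-4 column).  Tree file 3/3 of the node.

Content VERBATIM from the decomp-res lens-4 g19 delta `HOME/decomp-res-lens-4/g19/parts/g19-new.lean` (sha256 8a1606b4756fe017;
= §32–§37 of `HOME/decomp-res-lens-4/g19/RiderCut.lean` @4ef41708, whose §1–§31 are g18 CouplingCut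
@5bf7b2ca l.244–2968 VERBATIM and
ALREADY in the tree as `Theorems/HugValuationCut*`, `MarkingBudget*`, `WeightDescent*`, `FactorContact*`,
`CouplingCut*` and their
`MaxContactCut<Node>` wiring files).  HOME = run/shared/lean/pub/decomp-res.  Critic order 2026-08-30T17:52:13Z.

Inside the Theses cone: §36 BY NAME — the STRONG INDUCTION ON THE WEIGHT `forcedTowersTerminate_of_g19`, 30253
`NoForcedTowers` / THE HOST
32260 `NoSingularSurfaceHuggingTowers` / 32203 / 31570 from the all-weights residuals modulo the COSTUME ports
(`…_of_g19`, EXACT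
`noForcedTowers_iff_g19`, `noSingularSurfaceHuggingTowers_iff_g19`), necessity port-free (`…_of_item`,
`…_of_noForcedTowers`); §37 the root
EXACT with 31258 `NoEventuallyFreeTowers` as a booked conjunct (`noForcedTowers_iff_g19'`, the g18 trivial edge
30253 ⇒ 31258 inlined via
`ftt_iff_free_satellite` as in `MaxContactCutCouplingCut`).

[WRITER NOTE (decomp-res writer g6): the whole lens-4 chain lives in ONE namespace `…Theorems.HugValuationCut` (the tree's g14
namespace) so that the lens's `HugChain.`/`HugShadow.`/`MarkedShadow.` dot-notation extends the landed structures
verbatim; the lens's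
`noTower_iff_perfect_and_imperfect` is the tree's `ContactShadowKernels.noTower_iff_columns`; `set_option` lines
dropped; cone-free
(no `Theses` import) so the route file can import it for asides; the BY-NAME wiring to the MaxContactCut items is in the
`MaxContactCut<Node>` companion files.]
(Sources: CossartJannsenSaito2020 Key Thm. 6.40, Cor. 6.37, Lem. 6.35/6.36; BierstoneGrigorievMilmanWlodarczyk2011
§3; CossartPiltant2019 (rider census, imperfect ground fields); Abhyankar1956; Cutkosky2009 §2.1; Giraud1975;
BierstoneMilman1997; Wlodarczyk2005; Kollar2007 §3.)
-/

noncomputable section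

open CategoryTheory AlgebraicGeometry IsLocalRing
open Literature.AlgebraicGeometry.Resolution
open Summit.ResolutionOfSingularities.ResolutionOfSingularities.Theses
open Summit.ResolutionOfSingularities.ResolutionOfSingularities.Theorems
open WeakOrderReduction ForcedTowerClasses DivergentTowerClasses MonomialTowerClasses
open HugDimensionClasses HugDimensionKernels SurfaceShadowClasses SurfaceShadowKernels
open ContactShadowClasses (NoTowerImperfect)
open ContactShadowKernels (noTowerImperfect_of_noTower noTowerImperfect_mono noTower_iff_columns)
open NearPointCut (SingularClass singularSurface_iff_noTower)
open AbsoluteContactClasses (IsAbsContactAt)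

namespace Summit.ResolutionOfSingularities.ResolutionOfSingularities.Theorems.HugValuationCut

variable {K : Type} [Field K]

/-! ## §36 (g19 · NEW) Up to the booked MaxContactCut items BY NAME — all weights -/

/-- **THE ROOT PIECE AT EVERY WEIGHT** (strong induction on the weight). [folklore] -/
theorem forcedTowersTerminate_of_g19 (hMo : MaxContactCut.MonomialCornerAll) (hC : MaxContactCut.CurveLawAll)
    (hSL : MaxContactCut.SurfaceLawAll) (hH : MaxContactCut.NoHypersurfaceHuggingTowers) (hP : ShadowPortAll)
    (hM : MarkingPortAll) (hDesc : DescentPortAll) (hFC : FactorContactPortAll) (hCo : CouplingPortAll)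
    (hRi : RiderPortAll) (hO : NoOffLocusShadowTowers) (hNP : NoNonPrincipalInLocusTowers) (hPu : NoPurePrincipalTowers)
    (hR : NoIncommensurableWildDriftingImperfectTowers) : ∀ n : ℕ, 1 ≤ n → ForcedTowersTerminate n := by
  intro n
  induction n using Nat.strong_induction_on with
  | _ n ih =>
    intro hn
    exact ftt_step_of_g19 hn (hMo n hn) (hC n hn) (hSL n hn) (hH n hn) (hP n hn) (hM n hn) (hDesc n hn) (hFC n hn)
      (hCo n hn) (hRi n hn) (hO n hn) (hNP n hn) (hPu n hn) (hR n hn) fun n' h1 h2 => ih n' h2 h1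

/-- **30253 `MaxContactCut.NoForcedTowers` BY NAME.** [folklore] -/
theorem noForcedTowers_of_g19 (hMo : MaxContactCut.MonomialCornerAll) (hC : MaxContactCut.CurveLawAll)
    (hSL : MaxContactCut.SurfaceLawAll) (hH : MaxContactCut.NoHypersurfaceHuggingTowers) (hP : ShadowPortAll)
    (hM : MarkingPortAll) (hDesc : DescentPortAll) (hFC : FactorContactPortAll) (hCo : CouplingPortAll)
    (hRi : RiderPortAll) (hO : NoOffLocusShadowTowers) (hNP : NoNonPrincipalInLocusTowers) (hPu : NoPurePrincipalTowers)
    (hR : NoIncommensurableWildDriftingImperfectTowers) : MaxContactCut.NoForcedTowers :=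
  forcedTowersTerminate_of_g19 hMo hC hSL hH hP hM hDesc hFC hCo hRi hO hNP hPu hR

/-- g18's residual over all weights from the ports and the imperfect residual (lower weights from the induction). [folklore] -/
theorem noIncommensurableWildDriftingTowers_of_g19 (hMo : MaxContactCut.MonomialCornerAll) (hC : MaxContactCut.CurveLawAll)
    (hSL : MaxContactCut.SurfaceLawAll) (hH : MaxContactCut.NoHypersurfaceHuggingTowers) (hP : ShadowPortAll)
    (hM : MarkingPortAll) (hDesc : DescentPortAll) (hFC : FactorContactPortAll) (hCo : CouplingPortAll)
    (hRi : RiderPortAll) (hO : NoOffLocusShadowTowers) (hNP : NoNonPrincipalInLocusTowers) (hPu : NoPurePrincipalTowers)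
    (hR : NoIncommensurableWildDriftingImperfectTowers) : NoIncommensurableWildDriftingTowers :=
  fun n hn => incommensurableWildDrifting_of_g19 (hRi n hn) (hCo n hn)
    (fun n' h1 _ => forcedTowersTerminate_of_g19 hMo hC hSL hH hP hM hDesc hFC hCo hRi hO hNP hPu hR n' h1) (hR n hn)

/-- the decided half over all weights from the ports and the imperfect residual. [folklore] -/
theorem noIncommensurableWildDriftingPerfectTowers_of_g19 (hMo : MaxContactCut.MonomialCornerAll)
    (hC : MaxContactCut.CurveLawAll) (hSL : MaxContactCut.SurfaceLawAll) (hH : MaxContactCut.NoHypersurfaceHuggingTowers)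
    (hP : ShadowPortAll) (hM : MarkingPortAll) (hDesc : DescentPortAll) (hFC : FactorContactPortAll)
    (hCo : CouplingPortAll) (hRi : RiderPortAll) (hO : NoOffLocusShadowTowers) (hNP : NoNonPrincipalInLocusTowers)
    (hPu : NoPurePrincipalTowers) (hR : NoIncommensurableWildDriftingImperfectTowers) :
    NoIncommensurableWildDriftingPerfectTowers :=
  fun n hn => incommensurableWildDriftingPerfect_of_ports (hRi n hn) (hCo n hn)
    fun n' h1 _ => forcedTowersTerminate_of_g19 hMo hC hSL hH hP hM hDesc hFC hCo hRi hO hNP hPu hR n' h1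

/-- **THE HOST 32260 `MaxContactCut.NoSingularSurfaceHuggingTowers` BY NAME.** [folklore] -/
theorem noSingularSurfaceHuggingTowers_of_g19 (hMo : MaxContactCut.MonomialCornerAll) (hC : MaxContactCut.CurveLawAll)
    (hSL : MaxContactCut.SurfaceLawAll) (hH : MaxContactCut.NoHypersurfaceHuggingTowers) (hP : ShadowPortAll)
    (hM : MarkingPortAll) (hDesc : DescentPortAll) (hFC : FactorContactPortAll) (hCo : CouplingPortAll)
    (hRi : RiderPortAll) (hO : NoOffLocusShadowTowers) (hNP : NoNonPrincipalInLocusTowers) (hPu : NoPurePrincipalTowers)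
    (hR : NoIncommensurableWildDriftingImperfectTowers) : MaxContactCut.NoSingularSurfaceHuggingTowers :=
  noSingularSurfaceHuggingTowers_of_g18 hMo hC hSL hH hP hM hDesc hFC hCo hO hNP hPu
    (noIncommensurableWildDriftingTowers_of_g19 hMo hC hSL hH hP hM hDesc hFC hCo hRi hO hNP hPu hR)

/-- 32203 `MaxContactCut.NoSurfaceHuggingTowers` BY NAME. [folklore] -/
theorem noSurfaceHuggingTowers_of_g19 (hMo : MaxContactCut.MonomialCornerAll) (hC : MaxContactCut.CurveLawAll)
    (hSL : MaxContactCut.SurfaceLawAll) (hH : MaxContactCut.NoHypersurfaceHuggingTowers) (hP : ShadowPortAll)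
    (hM : MarkingPortAll) (hDesc : DescentPortAll) (hFC : FactorContactPortAll) (hCo : CouplingPortAll)
    (hRi : RiderPortAll) (hO : NoOffLocusShadowTowers) (hNP : NoNonPrincipalInLocusTowers) (hPu : NoPurePrincipalTowers)
    (hR : NoIncommensurableWildDriftingImperfectTowers) : MaxContactCut.NoSurfaceHuggingTowers :=
  noSurfaceHuggingTowers_of_g18 hMo hC hSL hH hP hM hDesc hFC hCo hO hNP hPu
    (noIncommensurableWildDriftingTowers_of_g19 hMo hC hSL hH hP hM hDesc hFC hCo hRi hO hNP hPu hR)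

/-- 31570 `MaxContactCut.NoHuggingTowers` BY NAME. [folklore] -/
theorem noHuggingTowers_of_g19 (hMo : MaxContactCut.MonomialCornerAll) (hC : MaxContactCut.CurveLawAll)
    (hSL : MaxContactCut.SurfaceLawAll) (hH : MaxContactCut.NoHypersurfaceHuggingTowers) (hP : ShadowPortAll)
    (hM : MarkingPortAll) (hDesc : DescentPortAll) (hFC : FactorContactPortAll) (hCo : CouplingPortAll)
    (hRi : RiderPortAll) (hO : NoOffLocusShadowTowers) (hNP : NoNonPrincipalInLocusTowers) (hPu : NoPurePrincipalTowers)
    (hR : NoIncommensurableWildDriftingImperfectTowers) : MaxContactCut.NoHuggingTowers :=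
  noHuggingTowers_of_g18 hMo hC hSL hH hP hM hDesc hFC hCo hO hNP hPu
    (noIncommensurableWildDriftingTowers_of_g19 hMo hC hSL hH hP hM hDesc hFC hCo hRi hO hNP hPu hR)

/-- Necessity, port-free: 32260 implies the imperfect residual over all weights. [folklore] -/
theorem noIncommensurableWildDriftingImperfectTowers_of_item (h : MaxContactCut.NoSingularSurfaceHuggingTowers) :
    NoIncommensurableWildDriftingImperfectTowers :=
  fun n hn => incommensurableWildDriftingImperfect_of_singularSurface (h n hn)

/-- Necessity, port-free: 30253 implies the imperfect residual over all weights. [folklore] -/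
theorem noIncommensurableWildDriftingImperfectTowers_of_noForcedTowers (h : MaxContactCut.NoForcedTowers) :
    NoIncommensurableWildDriftingImperfectTowers :=
  fun n hn => incommensurableWildDriftingImperfect_of_g18 (noIncommensurableWildDriftingTowers_of_noForcedTowers h n hn)

/-- **EXACT AT THE ROOT 30253 modulo the decided pieces and the six COSTUME ports**:
`MaxContactCut.NoForcedTowers ⟺ (O) ∧ (L,¬P) ∧ (L,P,pure) ∧ (L,P,drift,wild,incomm · IMPERFECT k)` over
all weights. [folklore] -/
theorem noForcedTowers_iff_g19 (hMo : MaxContactCut.MonomialCornerAll) (hC : MaxContactCut.CurveLawAll)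
    (hSL : MaxContactCut.SurfaceLawAll) (hH : MaxContactCut.NoHypersurfaceHuggingTowers) (hP : ShadowPortAll)
    (hM : MarkingPortAll) (hDesc : DescentPortAll) (hFC : FactorContactPortAll) (hCo : CouplingPortAll)
    (hRi : RiderPortAll) :
    MaxContactCut.NoForcedTowers ↔
      NoOffLocusShadowTowers ∧ NoNonPrincipalInLocusTowers ∧ NoPurePrincipalTowers ∧
        NoIncommensurableWildDriftingImperfectTowers :=
  ⟨fun h => ⟨(residuals_of_noForcedTowers h).1, (residuals_of_noForcedTowers h).2.1,
    (residuals_of_noForcedTowers h).2.2.1, noIncommensurableWildDriftingImperfectTowers_of_noForcedTowers h⟩,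
    fun h => noForcedTowers_of_g19 hMo hC hSL hH hP hM hDesc hFC hCo hRi h.1 h.2.1 h.2.2.1 h.2.2.2⟩

/-- **EXACT AT THE HOST 32260 modulo the decided pieces and the ports** (through the root induction). [folklore] -/
theorem noSingularSurfaceHuggingTowers_iff_g19 (hMo : MaxContactCut.MonomialCornerAll) (hC : MaxContactCut.CurveLawAll)
    (hSL : MaxContactCut.SurfaceLawAll) (hH : MaxContactCut.NoHypersurfaceHuggingTowers) (hP : ShadowPortAll)
    (hM : MarkingPortAll) (hDesc : DescentPortAll) (hFC : FactorContactPortAll) (hCo : CouplingPortAll)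
    (hRi : RiderPortAll) :
    MaxContactCut.NoSingularSurfaceHuggingTowers ↔
      NoOffLocusShadowTowers ∧ NoNonPrincipalInLocusTowers ∧ NoPurePrincipalTowers ∧
        NoIncommensurableWildDriftingImperfectTowers :=
  ⟨fun h => ⟨noOffLocusShadowTowers_of_item h, noNonPrincipalInLocusTowers_of_item h, noPurePrincipalTowers_of_item h,
    noIncommensurableWildDriftingImperfectTowers_of_item h⟩,
    fun h => noSingularSurfaceHuggingTowers_of_g19 hMo hC hSL hH hP hM hDesc hFC hCo hRi h.1 h.2.1 h.2.2.1 h.2.2.2⟩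

/-! ## §37 (g19 · NEW, rider) BY NAME: 31258 `MaxContactCut.NoEventuallyFreeTowers` as a booked conjunct of the root -/

/-- the g19 residual over all weights from 31258 BY NAME and the recurrent residual. [folklore] -/
theorem noIncommensurableWildDriftingImperfectTowers_of_tree (h : MaxContactCut.NoEventuallyFreeTowers)
    (hRec : NoRecurrentIncommensurableWildDriftingImperfectTowers) : NoIncommensurableWildDriftingImperfectTowers :=
  fun n hn => incommensurableWildDriftingImperfect_of_recurrent (h n hn) (hRec n hn)

/-- Necessity, port-free: 32260 implies the recurrent residual. [folklore] -/
theorem noRecurrentIncommensurableWildDriftingImperfectTowers_of_item (h : MaxContactCut.NoSingularSurfaceHuggingTowers) :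
    NoRecurrentIncommensurableWildDriftingImperfectTowers :=
  fun n hn => (incommensurableWildDriftingImperfect_iff_free_recurrent.mp
    (noIncommensurableWildDriftingImperfectTowers_of_item h n hn)).2

/-- **EXACT AT THE ROOT 30253 with 31258 as a booked conjunct**:
`NoForcedTowers ⟺ (O) ∧ (L,¬P) ∧ (L,P,pure) ∧ 31258 ∧ (L,P,drift,wild,incomm · IMPERFECT k ·
RECURRENT)`. [folklore] -/
theorem noForcedTowers_iff_g19' (hMo : MaxContactCut.MonomialCornerAll) (hC : MaxContactCut.CurveLawAll)
    (hSL : MaxContactCut.SurfaceLawAll) (hH : MaxContactCut.NoHypersurfaceHuggingTowers) (hP : ShadowPortAll)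
    (hM : MarkingPortAll) (hDesc : DescentPortAll) (hFC : FactorContactPortAll) (hCo : CouplingPortAll)
    (hRi : RiderPortAll) :
    MaxContactCut.NoForcedTowers ↔
      NoOffLocusShadowTowers ∧ NoNonPrincipalInLocusTowers ∧ NoPurePrincipalTowers ∧
        MaxContactCut.NoEventuallyFreeTowers ∧ NoRecurrentIncommensurableWildDriftingImperfectTowers :=
  ⟨fun h => ⟨(residuals_of_noForcedTowers h).1, (residuals_of_noForcedTowers h).2.1,
    (residuals_of_noForcedTowers h).2.2.1, fun n hn => (ftt_iff_free_satellite.mp (h n hn)).1,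
    fun n hn => (incommensurableWildDriftingImperfect_iff_free_recurrent.mp
      (noIncommensurableWildDriftingImperfectTowers_of_noForcedTowers h n hn)).2⟩,
    fun h => noForcedTowers_of_g19 hMo hC hSL hH hP hM hDesc hFC hCo hRi h.1 h.2.1 h.2.2.1
      (noIncommensurableWildDriftingImperfectTowers_of_tree h.2.2.2.1 h.2.2.2.2)⟩

end Summit.ResolutionOfSingularities.ResolutionOfSingularities.Theorems.HugValuationCut
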